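import Summits.QuantumFields.BalabanUV.Beta.GAN24.DerivativeRateTransferSqueeze

/-!
# `BalabanUV.Beta.GAN24.DerivativeRateTransferLoewnerGramConverge` — binder row G-an2-4 ∕ (CONV-C), route R6 «VALUES, NOT DERIVATIVES», PART 99:
# THE RATE-FREE END — WITHOUT (CONS): under the (STAB-ε_j,δ_j) steps with SUMMABLE slacks and a bounded diagonal the effective forms are ALMOST MONOTONE,
# hence CONVERGE entrywise; (CONS) buys the RATE of the tower END, not the existence of its limit
# (unit b2b-balaban-gan24-p3, gen 48; v1)

NOT IN PRINT; OUR PROOF (for the ROUTE; [folklore] — almost-monotone bounded real sequences converge (a product-weighted monotone majorant), polarisation; PART 20's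
`effForm_step_posSemidef_of_stabGram`, PART 29's `posSemidef_effForm` BY NAME).  HONEST FRAMING (cell contract, verbatim): «discharging `BetaPertH` makes Bałaban's
UV stability UNCONDITIONAL — a real constructive-QFT result; it is NOT the continuum limit and NOT the Clay problem.»  HONEST DEPENDENCY (verbatim): «continuum YM on T⁴
⇐ BetaPertH ∧ nine spine estimates (0/9 proved); BetaPertH ⇐ (D1) ∧ (D4) ∧ CAP+tail; G-an2-4 gates asym, D1 and NE2/3/4.»

WHY THIS FILE.  Every END of the route so far (PARTs 18, 20, 88, 90, 96) concludes a one-step RATE `|𝒮_{j+1}(a,b) − 𝒮_j(a,b)| ≤ C·θ^j` and pays for it with the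
consistency datum (CONS) [R8°, UNTYPED] — the only hypothesis that bounds the steps FROM ABOVE.  The (STAB-ε_j,δ_j) steps alone bound them FROM BELOW up to slack
(PART 20: `0 ≤ (1+ε_j)𝒮_{j+1} + δ_jℋ_{j+1}ᵀG_{j+1}ℋ_{j+1} − 𝒮_j`), i.e. at every vector `a_j ≤ (1+ε_j)a_{j+1} + r_j` with `a_j = ⟨v,𝒮_jv⟩ ≥ 0` and
`r_j = δ_j⟨v,ℋ_{j+1}ᵀG_{j+1}ℋ_{j+1}v⟩ ≥ 0`.  Such an ALMOST-MONOTONE sequence, if bounded, CONVERGES as soon as `Σε_j < ∞` and `Σr_j < ∞`: the weighted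
sequence `c_j = π_ja_j + Σ_{i<j}π_ir_i` (`π_j = Π_{i<j}(1+ε_i) ≤ e^{Σε}`) is monotone and bounded.  Polarising, the effective forms converge ENTRYWISE.  So the
existence of the limit form `𝒮_∞` — the «continuum limit of the unit-lattice effective action exists» half of (CONV-C) — needs NO (CONS): its inputs are the
(STAB) family's two schedules in SUMMABLE (not geometric) form, the Gram letter, and a bounded diagonal (a trial-field bound; or PART 94 when (CONS) is available
anyway).  (CONS) is what the RATE costs (`LimitForm.conv` wants the rate; an existence clause does not).  Road P4's monotone route (`MonotoneCovLimit`,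
`MonotoneTorusEffective`) is the `ε = δ = 0` case at `U = 1` in its own currency; this is the with-background shape the R6 suppliers deliver.

WHAT THIS FILE PROVES (0 sorry, 0 `def`, nothing cited):
* §1 (real sequences) `one_le_prod_one_add`, `prod_one_add_le_exp`, **`exists_tendsto_of_almostMonotone`**: `0 ≤ a_j ≤ B`, `0 ≤ ε_j`, `0 ≤ r_j`,
  `Σ_{i<n}ε_i ≤ Sε`, `Σ_{i<n}r_i ≤ Sr`, `a_j ≤ (1+ε_j)a_{j+1} + r_j` ⟹ `a` converges.
* §2 (two levels ∕ tower) `form_step_le_of_stabGram` (the almost-monotone step at one vector from PART 20's PSD step), `form_add_le_two_mul`,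
  **`exists_effForm_limit_of_stabGram_summable`** — PART 20's tower data WITHOUT (CONS): PSD `H j`, nonsingular bordered matrices, `Qc (j+1) = Qc j·Qf j`,
  PSD carriers, (STAB-ε_j,δ_j) with `0 ≤ ε_j, δ_j`, `Σ_{i<n}ε_i ≤ Sε`, the Gram letter `⟨v… ⟩`: `|(ℋ_jᵀG_jℋ_j)_{ab}| ≤ N_j` with `Σ_{i<n}δ_iN_{i+1} ≤ Sδ`, and the
  diagonal bound `𝒮_j(a,a) ≤ B` ⟹ `∃ 𝒮_∞, ∀ a b, 𝒮_j(a,b) → 𝒮_∞(a,b)`.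
WHAT IT DOES NOT DO: give a rate (that is (CONS)'s job: PARTs 18 ∕ 20 ∕ 88 ∕ 96); identify `𝒮_∞`; decay of `𝒮_∞` (S2 ∕ (H2)).  SUPPLIER work on route C-R6° (rank 2,
REDUCTION); no consumer of record; NEVER «G-an2-4 closed»; NOT (CONV-C), NOT D1, NOT `BetaPertH`, NOT continuum, NOT Clay.  Records: `HOME/b2b-balaban-gan24-p3/gen48/R6-LEDGER-NOTE.md`.
-/

noncomputable section

open Set Matrix Finset Filter Topology

namespace Summit.QuantumFields.BalabanUV.Beta.GAN24.DerivativeRateTransferLoewnerGramConverge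

open Literature.MathematicalPhysics.QuantumFieldTheory.Balaban1983to89.Beta.Composition (kkt)
open Literature.MathematicalPhysics.QuantumFieldTheory.Balaban1983to89.Beta.CompositionSingular (effForm minOp)
open Summit.QuantumFields.BalabanUV.Beta.GAN24.DerivativeRateTransferLoewnerKKT (transpose_eq_of_posSemidef single_dotProduct_mulVec_single)
open Summit.QuantumFields.BalabanUV.Beta.GAN24.DerivativeRateTransferLoewnerGram (effForm_step_posSemidef_of_stabGram)
open Summit.QuantumFields.BalabanUV.Beta.GAN24.DerivativeRateTransferSqueeze (posSemidef_effForm)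

/-! ## §1 Almost-monotone bounded sequences converge -/

section Scalar

variable {a e r : ℕ → ℝ} {B Se Sr : ℝ}

/-- `1 ≤ Π_{i<n}(1 + ε_i)` for `ε ≥ 0`. [folklore] -/
theorem one_le_prod_one_add (he0 : ∀ j, 0 ≤ e j) (n : ℕ) : 1 ≤ ∏ i ∈ range n, (1 + e i) := by
  induction n with
  | zero => simp
  | succ n ih => rw [Finset.prod_range_succ]; exact one_le_mul_of_one_le_of_one_le ih (by linarith [he0 n])

/-- `Π_{i<n}(1 + ε_i) ≤ exp(Σ_{i<n}ε_i) ≤ exp Sε`. [folklore] -/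
theorem prod_one_add_le_exp (he0 : ∀ j, 0 ≤ e j) (hSe : ∀ n, ∑ i ∈ range n, e i ≤ Se) (n : ℕ) :
    ∏ i ∈ range n, (1 + e i) ≤ Real.exp Se := by
  calc ∏ i ∈ range n, (1 + e i) ≤ ∏ i ∈ range n, Real.exp (e i) :=
        Finset.prod_le_prod (fun i _ => by linarith [he0 i]) fun i _ => by rw [add_comm]; exact Real.add_one_le_exp (e i)
    _ = Real.exp (∑ i ∈ range n, e i) := (Real.exp_sum _ _).symm
    _ ≤ Real.exp Se := Real.exp_le_exp.mpr (hSe n)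

/-- [folklore] a monotone sequence bounded above converges. -/
theorem exists_tendsto_of_monotone_le {f : ℕ → ℝ} {M : ℝ} (hf : Monotone f) (hM : ∀ n, f n ≤ M) : ∃ l, Tendsto f atTop (𝓝 l) :=
  ⟨_, tendsto_atTop_ciSup hf ⟨M, by rintro _ ⟨n, rfl⟩; exact hM n⟩⟩

/-- **`exists_tendsto_of_almostMonotone` — ALMOST-MONOTONE BOUNDED SEQUENCES CONVERGE** [folklore; our proof]: `0 ≤ a_j ≤ B`, `0 ≤ ε_j` with
`Σ_{i<n}ε_i ≤ Sε`, `0 ≤ r_j` with `Σ_{i<n}r_i ≤ Sr`, and `a_j ≤ (1 + ε_j)a_{j+1} + r_j` for all `j` ⟹ `a` converges.  (`π_n = Π_{i<n}(1+ε_i) ∈ [1, e^{Sε}]` is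
monotone; `s_n = Σ_{i<n}π_ir_i` is monotone and `≤ e^{Sε}Sr`; `c_n = π_na_n + s_n` is monotone and `≤ e^{Sε}(B + Sr)`; `a_n = (c_n − s_n)∕π_n`.) -/
theorem exists_tendsto_of_almostMonotone (ha0 : ∀ j, 0 ≤ a j) (haB : ∀ j, a j ≤ B) (he0 : ∀ j, 0 ≤ e j) (hr0 : ∀ j, 0 ≤ r j)
    (hSe : ∀ n, ∑ i ∈ range n, e i ≤ Se) (hSr : ∀ n, ∑ i ∈ range n, r i ≤ Sr) (hstep : ∀ j, a j ≤ (1 + e j) * a (j + 1) + r j) :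
    ∃ l, Tendsto a atTop (𝓝 l) := by
  set π : ℕ → ℝ := fun n => ∏ i ∈ range n, (1 + e i) with hπ
  have hπ1 : ∀ n, 1 ≤ π n := one_le_prod_one_add he0
  have hπE : ∀ n, π n ≤ Real.exp Se := prod_one_add_le_exp he0 hSe
  have hπsucc : ∀ n, π (n + 1) = π n * (1 + e n) := fun n => Finset.prod_range_succ _ _
  have hπmono : Monotone π := monotone_nat_of_le_succ fun n => by
    rw [hπsucc]; have := hπ1 n; have := he0 n; nlinarith
  have hE0 : 0 < Real.exp Se := Real.exp_pos _
  -- the weighted remainder sums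
  set s : ℕ → ℝ := fun n => ∑ i ∈ range n, π i * r i with hs
  have hsmono : Monotone s := monotone_nat_of_le_succ fun n => by
    simp only [hs, Finset.sum_range_succ]; have := mul_nonneg (zero_le_one.trans (hπ1 n)) (hr0 n); linarith
  have hsB : ∀ n, s n ≤ Real.exp Se * Sr := fun n => by
    calc s n ≤ ∑ i ∈ range n, Real.exp Se * r i :=
          Finset.sum_le_sum fun i _ => mul_le_mul_of_nonneg_right (hπE i) (hr0 i)
      _ = Real.exp Se * ∑ i ∈ range n, r i := (Finset.mul_sum _ _ _).symm
      _ ≤ Real.exp Se * Sr := mul_le_mul_of_nonneg_left (hSr n) hE0.le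
  -- the weighted monotone majorant
  set c : ℕ → ℝ := fun n => π n * a n + s n with hc
  have hcmono : Monotone c := monotone_nat_of_le_succ fun n => by
    simp only [hc, hs, Finset.sum_range_succ, hπsucc]
    have h1 := mul_le_mul_of_nonneg_left (hstep n) (zero_le_one.trans (hπ1 n))
    nlinarith
  have hcB : ∀ n, c n ≤ Real.exp Se * B + Real.exp Se * Sr := fun n => by
    have h1 : π n * a n ≤ Real.exp Se * B := mul_le_mul (hπE n) (haB n) (ha0 n) hE0.le
    simp only [hc]; linarith [hsB n]
  obtain ⟨lc, hlc⟩ := exists_tendsto_of_monotone_le hcmono hcB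
  obtain ⟨ls, hls⟩ := exists_tendsto_of_monotone_le hsmono hsB
  obtain ⟨lπ, hlπ⟩ := exists_tendsto_of_monotone_le hπmono hπE
  have hlπ1 : 1 ≤ lπ := ge_of_tendsto' hlπ hπ1
  refine ⟨(lc - ls) / lπ, ?_⟩
  have hrepr : a = fun n => (c n - s n) / π n := by
    funext n
    have : π n ≠ 0 := by linarith [hπ1 n]
    simp only [hc]; field_simp; ring
  rw [hrepr]
  exact (hlc.sub hls).div hlπ (by linarith)

end Scalar

/-! ## §2 The almost-monotone step of the effective forms and the rate-free END -/

section Forms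

variable {c ν ν' : Type*} [Fintype c] [Fintype ν] [Fintype ν'] [DecidableEq c] [DecidableEq ν] [DecidableEq ν']
variable {H : Matrix ν ν ℝ} {Q : Matrix c ν ℝ} {H' : Matrix ν' ν' ℝ} {Q' : Matrix c ν' ℝ} {Qf : Matrix ν ν' ℝ} {G : Matrix ν' ν' ℝ} {ε δ : ℝ}

/-- **`form_step_le_of_stabGram` — THE ALMOST-MONOTONE STEP AT ONE VECTOR** [our proof; PART 20's PSD step read at `v`]: (STAB-ε,δ) ⟹
`⟨v,𝒮v⟩ ≤ (1+ε)⟨v,𝒮′v⟩ + δ⟨v,ℋ′ᵀGℋ′v⟩`. -/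
theorem form_step_le_of_stabGram (hH : H.PosSemidef) (hH' : H'.PosSemidef) (h : IsUnit (kkt H Q).det) (h' : IsUnit (kkt H' Q').det)
    (hcomp : Q' = Q * Qf) (hG : Gᵀ = G) (hstab : ((1 + ε) • H' + δ • G - Qfᵀ * H * Qf).PosSemidef) (v : c → ℝ) :
    v ⬝ᵥ (effForm H Q *ᵥ v) ≤ (1 + ε) * (v ⬝ᵥ (effForm H' Q' *ᵥ v)) + δ * (v ⬝ᵥ (((minOp H' Q')ᵀ * G * minOp H' Q') *ᵥ v)) := by
  have hD := (effForm_step_posSemidef_of_stabGram hH hH' h h' hcomp hG hstab).dotProduct_mulVec_nonneg v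
  simp only [star_trivial, sub_mulVec, add_mulVec, smul_mulVec, dotProduct_sub, dotProduct_add, dotProduct_smul, smul_eq_mul] at hD
  linarith

omit [Fintype ν] [DecidableEq c] [DecidableEq ν] in
/-- `⟨u + w, S(u + w)⟩ ≤ 2⟨u,Su⟩ + 2⟨w,Sw⟩` for a PSD `S`. [folklore] -/
theorem form_add_le_two_mul {S : Matrix c c ℝ} (hS : S.PosSemidef) (u w : c → ℝ) :
    (u + w) ⬝ᵥ (S *ᵥ (u + w)) ≤ 2 * (u ⬝ᵥ (S *ᵥ u)) + 2 * (w ⬝ᵥ (S *ᵥ w)) := by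
  have h0 := hS.dotProduct_mulVec_nonneg (u - w)
  simp only [star_trivial, mulVec_sub, dotProduct_sub, sub_dotProduct] at h0
  simp only [mulVec_add, dotProduct_add, add_dotProduct]
  linarith

omit [Fintype ν] [DecidableEq ν] in
/-- polarisation for a symmetric matrix: `2·S a b = ⟨e_a + e_b, S(e_a + e_b)⟩ − S a a − S b b`. [folklore] -/
theorem two_mul_apply_eq_polar {S : Matrix c c ℝ} (hS : Sᵀ = S) (a b : c) :
    2 * S a b = (Pi.single a (1 : ℝ) + Pi.single b 1) ⬝ᵥ (S *ᵥ (Pi.single a 1 + Pi.single b 1)) - S a a - S b b := by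
  have hba : S b a = S a b := by rw [← hS, transpose_apply, hS]
  simp only [mulVec_add, dotProduct_add, add_dotProduct, single_dotProduct_mulVec_single]
  rw [single_dotProduct, one_mul, Matrix.mulVec_single_one, Matrix.col_apply,
    single_dotProduct, one_mul, Matrix.mulVec_single_one, Matrix.col_apply, hba]
  ring

end Forms

section Tower

variable {c : Type*} [Fintype c] [DecidableEq c]
variable {ι : ℕ → Type*} [∀ j, Fintype (ι j)] [∀ j, DecidableEq (ι j)]
variable {H : ∀ j, Matrix (ι j) (ι j) ℝ} {Qf : ∀ j, Matrix (ι j) (ι (j + 1)) ℝ} {Qc : ∀ j, Matrix c (ι j) ℝ}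
variable {G : ∀ j, Matrix (ι j) (ι j) ℝ} {ε δ N : ℕ → ℝ} {B Sε Sδ : ℝ}

/-- **`exists_effForm_limit_of_stabGram_summable` — THE RATE-FREE END, WITHOUT (CONS)** [our proof]: PSD fine forms `H j`, nonsingular bordered matrices,
`Qc (j+1) = Qc j·Qf j`, PSD carriers `G j`; (STAB-ε_j,δ_j) `(Qf j)ᵀH_j(Qf j) ≤ (1 + ε_j)·H_{j+1} + δ_j·G_{j+1}` with `0 ≤ ε_j`, `0 ≤ δ_j`, bounded partial sums
`Σ_{i<n}ε_i ≤ Sε`; the Gram letter `|(ℋ_jᵀG_jℋ_j)_{ab}| ≤ N_j` with `Σ_{i<n}δ_i·N_{i+1} ≤ Sδ`; and a bounded diagonal `𝒮_j(a,a) ≤ B` ⟹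
`∃ 𝒮_∞ : Matrix c c ℝ, ∀ a b, 𝒮_j(a,b) → 𝒮_∞(a,b)`.  No (CONS), no rate. -/
theorem exists_effForm_limit_of_stabGram_summable (hH : ∀ j, (H j).PosSemidef) (hk : ∀ j, IsUnit (kkt (H j) (Qc j)).det)
    (hcomp : ∀ j, Qc (j + 1) = Qc j * Qf j) (hGp : ∀ j, (G j).PosSemidef) (hε0 : ∀ j, 0 ≤ ε j) (hδ0 : ∀ j, 0 ≤ δ j)
    (hstab : ∀ j, ((1 + ε j) • H (j + 1) + δ j • G (j + 1) - (Qf j)ᵀ * H j * Qf j).PosSemidef)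
    (hSε : ∀ n, ∑ i ∈ range n, ε i ≤ Sε)
    (hN : ∀ j a b, |((minOp (H j) (Qc j))ᵀ * G j * minOp (H j) (Qc j)) a b| ≤ N j)
    (hSδ : ∀ n, ∑ i ∈ range n, δ i * N (i + 1) ≤ Sδ) (hB : ∀ j a, effForm (H j) (Qc j) a a ≤ B) :
    ∃ Sinf : Matrix c c ℝ, ∀ a b : c, Tendsto (fun j => effForm (H j) (Qc j) a b) atTop (𝓝 (Sinf a b)) := by
  -- the PSD letters
  have hSp : ∀ j, (effForm (H j) (Qc j)).PosSemidef := fun j => posSemidef_effForm (hH j) (hk j)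
  have hSt : ∀ j, (effForm (H j) (Qc j))ᵀ = effForm (H j) (Qc j) := fun j => transpose_eq_of_posSemidef (hSp j)
  have hMp : ∀ j, ((minOp (H j) (Qc j))ᵀ * G j * minOp (H j) (Qc j)).PosSemidef := fun j => by
    have h := (hGp j).conjTranspose_mul_mul_same (minOp (H j) (Qc j))
    rwa [Matrix.conjTranspose_eq_transpose_of_trivial] at h
  -- per-vector convergence: a bounded almost-monotone sequence
  have key : ∀ (v : c → ℝ) (Bv k : ℝ), 0 ≤ k → (∀ j, v ⬝ᵥ (effForm (H j) (Qc j) *ᵥ v) ≤ Bv) →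
      (∀ j, v ⬝ᵥ (((minOp (H j) (Qc j))ᵀ * G j * minOp (H j) (Qc j)) *ᵥ v) ≤ k * N j) →
      ∃ l, Tendsto (fun j => v ⬝ᵥ (effForm (H j) (Qc j) *ᵥ v)) atTop (𝓝 l) := by
    intro v Bv k hk0 hvB hvN
    have ha0 : ∀ j, 0 ≤ v ⬝ᵥ (effForm (H j) (Qc j) *ᵥ v) := fun j => by
      simpa only [star_trivial] using (hSp j).dotProduct_mulVec_nonneg v
    have hm0 : ∀ j, 0 ≤ v ⬝ᵥ (((minOp (H j) (Qc j))ᵀ * G j * minOp (H j) (Qc j)) *ᵥ v) := fun j => by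
      simpa only [star_trivial] using (hMp j).dotProduct_mulVec_nonneg v
    refine exists_tendsto_of_almostMonotone (e := ε) (r := fun j => δ j * (v ⬝ᵥ (((minOp (H (j + 1)) (Qc (j + 1)))ᵀ * G (j + 1) *
      minOp (H (j + 1)) (Qc (j + 1))) *ᵥ v))) (Sr := k * Sδ) ha0 hvB hε0 (fun j => mul_nonneg (hδ0 j) (hm0 (j + 1))) hSε
      (fun n => ?_) fun j => ?_
    · calc ∑ i ∈ range n, δ i * (v ⬝ᵥ (((minOp (H (i + 1)) (Qc (i + 1)))ᵀ * G (i + 1) * minOp (H (i + 1)) (Qc (i + 1))) *ᵥ v))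
          ≤ ∑ i ∈ range n, k * (δ i * N (i + 1)) :=
            Finset.sum_le_sum fun i _ => by
              have := mul_le_mul_of_nonneg_left (hvN (i + 1)) (hδ0 i); nlinarith
        _ = k * ∑ i ∈ range n, δ i * N (i + 1) := (Finset.mul_sum _ _ _).symm
        _ ≤ k * Sδ := mul_le_mul_of_nonneg_left (hSδ n) hk0
    · exact form_step_le_of_stabGram (hH j) (hH (j + 1)) (hk j) (hk (j + 1)) (hcomp j) (transpose_eq_of_posSemidef (hGp (j + 1)))
        (hstab j) v
  -- diagonal and polarised sequences
  have hdiag : ∀ a, ∃ l, Tendsto (fun j => effForm (H j) (Qc j) a a) atTop (𝓝 l) := fun a => by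
    obtain ⟨l, hl⟩ := key (Pi.single a 1) B 1 zero_le_one
      (fun j => by rw [single_dotProduct_mulVec_single]; exact hB j a)
      (fun j => by rw [single_dotProduct_mulVec_single, one_mul]; exact (abs_le.mp (hN j a a)).2)
    exact ⟨l, by simpa only [single_dotProduct_mulVec_single] using hl⟩
  have hpair : ∀ a b, ∃ l, Tendsto (fun j => (Pi.single a (1 : ℝ) + Pi.single b 1) ⬝ᵥ
      (effForm (H j) (Qc j) *ᵥ (Pi.single a 1 + Pi.single b 1))) atTop (𝓝 l) := fun a b =>
    key (Pi.single a 1 + Pi.single b 1) (2 * B + 2 * B) 4 (by norm_num)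
      (fun j => by
        have h := form_add_le_two_mul (hSp j) (Pi.single a 1) (Pi.single b 1)
        rw [single_dotProduct_mulVec_single, single_dotProduct_mulVec_single] at h
        linarith [hB j a, hB j b])
      (fun j => by
        have h := form_add_le_two_mul (hMp j) (Pi.single a 1) (Pi.single b 1)
        rw [single_dotProduct_mulVec_single, single_dotProduct_mulVec_single] at h
        linarith [(abs_le.mp (hN j a a)).2, (abs_le.mp (hN j b b)).2])
  have hab : ∀ a b, ∃ l, Tendsto (fun j => effForm (H j) (Qc j) a b) atTop (𝓝 l) := fun a b => by
    obtain ⟨l₁, h₁⟩ := hdiag a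
    obtain ⟨l₂, h₂⟩ := hdiag b
    obtain ⟨l₃, h₃⟩ := hpair a b
    refine ⟨(l₃ - l₁ - l₂) / 2, ?_⟩
    have hrepr : (fun j => effForm (H j) (Qc j) a b) = fun j =>
        ((Pi.single a (1 : ℝ) + Pi.single b 1) ⬝ᵥ (effForm (H j) (Qc j) *ᵥ (Pi.single a 1 + Pi.single b 1)) -
          effForm (H j) (Qc j) a a - effForm (H j) (Qc j) b b) / 2 := by
      funext j; rw [← two_mul_apply_eq_polar (hSt j) a b]; ring
    rw [hrepr]
    exact ((h₃.sub h₁).sub h₂).div_const 2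
  exact ⟨fun a b => (hab a b).choose, fun a b => (hab a b).choose_spec⟩

end Tower

end Summit.QuantumFields.BalabanUV.Beta.GAN24.DerivativeRateTransferLoewnerGramConverge

end
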